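import Summits.Ventures.HodgeRepro2.T5U11Product
import Summits.Ventures.HodgeRepro2.T5SU11FibrationCartan
import Summits.Ventures.HodgeRepro2.T6N43Hyp

/-!
# T6N43RuhlHaar — the Rühl display `Hyp.Ruhl1970_A2f` is a THEOREM for every Haar measure of `U(1,1)`

FILED by seat t6-p6 (gen 19, wave 1; staged gen 18 as RS-N4.3 continuation readiness, step 5).

The display `Hyp.Ruhl1970_A2f 𝒟` (T6N43Hyp.lean) records Rühl's radial Haar formula for a datum `𝒟` on
`H = U(1,1)`: the push-forward of the datum's Haar measure `𝒟.μ` under Rühl's parameter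
`𝒟.eta g = 2 arsinh ‖g₁₀‖` is `c · ½ sinh η dη` on `η > 0`, `c > 0`.  On an abstract carrier this is a
hypothesis (the kernel has no group structure on `H`); on the HOST carrier `U(1,1) = T5U11Unimodular.U11`
with a genuine Haar measure (the `haarU11` of T6N43HostCarriers, filed in WAVE 1 as p437619) it is a
THEOREM, proved here
from p1's kernel record of the Haar measure of `SU(1,1)` through the disc:
* `T5U11Product.map_mulHom_prod_eq_smul`: `(μ_C ⊗ μ_S)` pushed by `(λ, h) ↦ λ h` is `c₁ · μ_U`;
* `T5SU11FibrationHaar.nu_eq_smul`: `ν = Φ_*(poincare ⊗ μ_C) = c₂ · μ_S`, `Φ(z, u) = s(z) · rot u`;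
* the radial part (this file): `η(s(z) rot u) = 2 arsinh (‖z‖ / √(1 - ‖z‖²))` depends on `z` alone, and
  `(z ↦ η) _* poincare = π · ½ sinh η dη` by polar coordinates (`Complex.lintegral_comp_polarCoord_symm`)
  and the substitution `r = tanh (η/2)` (`MeasureTheory.lintegral_image_eq_lintegral_abs_deriv_mul`, p1's
  `T5CartanCoordinates.hasDerivAt_tanh` / `one_sub_tanh_sq` / `tanh_image_Ioi`).
No print input: Rühl's formula is DERIVED, not displayed (the display's print locator is T6N43Hyp's).
Axioms: {propext, Classical.choice, Quot.sound}.  §8(d): uses an L-value-free non-vanishing device: NO.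

Filed in Tier-6 WAVE 1 as p437622 (ACCEPTED 2026-08-26T10:20:45Z, commit 221f5d7d5dbc); this v2 differs from the filed
bytes in this module docstring only — the «(staged)» tags on sibling files, all filed in WAVE 1, replaced by their
filing references (the PARK release clause, STATUS l. 12943 / l. 13037 (1)); every declaration byte-identical.
-/

namespace Summit.Ventures.HodgeRepro2.T6.N43RuhlHaar

open MeasureTheory MeasureTheory.Measure Set Metric
open T5SU11Unimodular T5U11Unimodular T5U11Product T5SU11Fibration T5SU11FibrationHaar T5PoincareMeasure
  T5HaarCircle
open scoped ENNReal NNReal Real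

/-! ### §1 Rühl's radial measure and the radial parameter of the disc -/

/-- Rühl's radial measure `½ sinh η dη` on `η > 0`: the right-hand side of the display
`Hyp.Ruhl1970_A2f` before its scalar. -/
noncomputable def ruhlRadial : Measure ℝ :=
  (volume.restrict (Ioi (0 : ℝ))).withDensity (fun η => ENNReal.ofReal (1 / 2 * Real.sinh η))

/-- The radial Cartan parameter as a function of the radius: `etaRad r = 2 arsinh (r / √(1 - r²))`
(`= 2 artanh r` for `0 ≤ r < 1`). -/
noncomputable def etaRad (r : ℝ) : ℝ := 2 * Real.arsinh (r / Real.sqrt (1 - r ^ 2))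

/-- The radial Cartan parameter of a point of the disc, `etaDisc z = etaRad ‖z‖`: Rühl's `η` of the
section `s(z)` (its `(1,0)` entry has norm `‖z‖ / √(1 - ‖z‖²)`). -/
noncomputable def etaDisc (z : ℂ) : ℝ := etaRad ‖z‖

/-- `etaRad` is measurable. -/
lemma measurable_etaRad : Measurable etaRad := by
  unfold etaRad
  exact (Real.continuous_arsinh.measurable.comp
    (measurable_id.div (measurable_const.sub (measurable_id.pow_const 2)).sqrt)).const_mul 2

/-- `etaDisc` is measurable. -/
lemma measurable_etaDisc : Measurable etaDisc :=
  measurable_etaRad.comp measurable_norm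

/-- **The substitution `r = tanh t`**: `etaRad (tanh t) = 2 t`. -/
lemma etaRad_tanh (t : ℝ) : etaRad (Real.tanh t) = 2 * t := by
  unfold etaRad
  have hc : 0 < Real.cosh t := Real.cosh_pos t
  have h1 : Real.sqrt (1 - Real.tanh t ^ 2) = 1 / Real.cosh t := by
    rw [T5CartanCoordinates.one_sub_tanh_sq, one_div, Real.sqrt_inv, one_div, Real.sqrt_sq hc.le]
  rw [h1, Real.tanh_eq_sinh_div_cosh, div_div_eq_mul_div, div_one, div_mul_cancel₀ _ hc.ne',
    Real.arsinh_sinh]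

/-- The same with `t = η / 2`: `etaRad (tanh (η/2)) = η`. -/
lemma etaRad_tanh_half (η : ℝ) : etaRad (Real.tanh (η / 2)) = η := by
  rw [etaRad_tanh]; ring

/-! ### §2 the radial density: `(1 - r²)⁻² r dr` under `r = tanh (η/2)` is `¼ sinh η dη` -/

/-- `r = tanh (η/2)` has derivative `(1 / cosh (η/2)²) · (1/2)`. -/
lemma hasDerivAt_tanh_half (η : ℝ) :
    HasDerivAt (fun η : ℝ => Real.tanh (η / 2)) (1 / Real.cosh (η / 2) ^ 2 * (1 / 2)) η := by
  have h := (T5CartanCoordinates.hasDerivAt_tanh (η / 2)).comp η ((hasDerivAt_id η).div_const 2)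
  simpa [Function.comp_def] using h

/-- `η ↦ tanh (η/2)` is injective. -/
lemma tanh_half_injective : Function.Injective (fun η : ℝ => Real.tanh (η / 2)) := by
  intro x y h
  have := Real.tanh_injective h
  linarith

/-- `η ↦ tanh (η/2)` maps `(0, ∞)` onto `(0, 1)`. -/
lemma tanh_half_image_Ioi : (fun η : ℝ => Real.tanh (η / 2)) '' Ioi 0 = Ioo 0 1 := by
  have h : (fun η : ℝ => Real.tanh (η / 2)) = Real.tanh ∘ (fun η : ℝ => η / 2) := rfl
  have h2 : (fun η : ℝ => η / 2) '' Ioi 0 = Ioi 0 := by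
    ext x
    constructor
    · rintro ⟨y, hy, rfl⟩
      exact half_pos (mem_Ioi.mp hy)
    · intro hx
      exact ⟨2 * x, mem_Ioi.mpr (mul_pos two_pos (mem_Ioi.mp hx)), by ring⟩
  rw [h, Set.image_comp, h2, T5CartanCoordinates.tanh_image_Ioi]

/-- **The radial Jacobian**: `|(1/cosh²(η/2)) · ½| · tanh (η/2) · (1 - tanh (η/2)²)⁻² = sinh η / 4`. -/
lemma jacobian_eq (η : ℝ) :
    |1 / Real.cosh (η / 2) ^ 2 * (1 / 2)| *
      (Real.tanh (η / 2) * (1 / (1 - Real.tanh (η / 2) ^ 2) ^ 2)) = Real.sinh η / 4 := by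
  have hc : 0 < Real.cosh (η / 2) := Real.cosh_pos _
  rw [T5CartanCoordinates.one_sub_tanh_sq, Real.tanh_eq_sinh_div_cosh,
    abs_of_pos (by positivity)]
  have h2 : Real.sinh η = 2 * Real.sinh (η / 2) * Real.cosh (η / 2) := by
    rw [← Real.sinh_two_mul]; ring_nf
  rw [h2]
  field_simp
  ring

/-! ### §3 the push-forward of the Poincaré measure under the radial parameter is `π · ½ sinh η dη` -/

/-- The radial integrand after polar coordinates: `r · (1 - r²)⁻² · 1_B(etaRad r)` on `0 < r < 1`. -/
noncomputable def radInt (B : Set ℝ) (r : ℝ) : ℝ≥0∞ :=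
  (Ioo (0 : ℝ) 1).indicator
    (fun r => ENNReal.ofReal r *
      (ENNReal.ofReal (1 / (1 - r ^ 2) ^ 2) * (etaRad ⁻¹' B).indicator 1 r)) r

/-- `radInt B` is measurable for measurable `B`. -/
lemma measurable_radInt {B : Set ℝ} (hB : MeasurableSet B) : Measurable (radInt B) := by
  unfold radInt
  refine Measurable.indicator ?_ measurableSet_Ioo
  refine (ENNReal.measurable_ofReal.comp measurable_id).mul ?_
  refine (ENNReal.measurable_ofReal.comp ?_).mul ?_
  · exact measurable_const.div ((measurable_const.sub (measurable_id.pow_const 2)).pow_const 2)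
  · exact measurable_one.indicator (hB.preimage measurable_etaRad)

/-- **Polar coordinates**: `poincare (η⁻¹ B) = (∫_{r > 0} radInt B r dr) · 2π`. -/
lemma poincare_preimage_eq (B : Set ℝ) (hB : MeasurableSet B) :
    poincare (etaDisc ⁻¹' B) = (∫⁻ r in Ioi (0 : ℝ), radInt B r) * ENNReal.ofReal (2 * π) := by
  set S : Set ℂ := etaDisc ⁻¹' B ∩ ball 0 1 with hS
  have hSm : MeasurableSet S := (hB.preimage measurable_etaDisc).inter measurableSet_ball
  have h1 : poincare (etaDisc ⁻¹' B) = ∫⁻ z, S.indicator (fun z => ENNReal.ofReal (dens z)) z := by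
    rw [poincare, withDensity_apply _ (hB.preimage measurable_etaDisc),
      Measure.restrict_restrict (hB.preimage measurable_etaDisc), lintegral_indicator hSm]
  have h2 : ∫⁻ z, S.indicator (fun z => ENNReal.ofReal (dens z)) z =
      ∫⁻ p in Ioi (0 : ℝ) ×ˢ Ioo (-π) π,
        ENNReal.ofReal p.1 * S.indicator (fun z => ENNReal.ofReal (dens z))
          (Complex.polarCoord.symm p) := by
    rw [← Complex.lintegral_comp_polarCoord_symm, polarCoord_target]
    rfl
  have h3 : Set.EqOn
      (fun p : ℝ × ℝ => ENNReal.ofReal p.1 *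
        S.indicator (fun z => ENNReal.ofReal (dens z)) (Complex.polarCoord.symm p))
      (fun p : ℝ × ℝ => radInt B p.1) (Ioi (0 : ℝ) ×ˢ Ioo (-π) π) := by
    rintro ⟨r, θ⟩ ⟨hr, -⟩
    have hr : 0 < r := hr
    have hn : ‖Complex.polarCoord.symm (r, θ)‖ = r := by
      rw [Complex.norm_polarCoord_symm, abs_of_pos hr]
    have hmem : Complex.polarCoord.symm (r, θ) ∈ S ↔ (etaRad r ∈ B ∧ r < 1) := by
      rw [hS, Set.mem_inter_iff, Set.mem_preimage, mem_ball_zero_iff, hn, etaDisc, hn]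
    have hdens : dens (Complex.polarCoord.symm (r, θ)) = 1 / (1 - r ^ 2) ^ 2 := by
      rw [dens, Complex.normSq_eq_norm_sq, hn]
    show ENNReal.ofReal r * S.indicator (fun z => ENNReal.ofReal (dens z))
      (Complex.polarCoord.symm (r, θ)) = radInt B r
    rw [radInt]
    by_cases h2 : r < 1
    · have hI : r ∈ Ioo (0 : ℝ) 1 := ⟨hr, h2⟩
      rw [Set.indicator_of_mem hI]
      by_cases h1 : etaRad r ∈ B
      · rw [Set.indicator_of_mem (hmem.mpr ⟨h1, h2⟩),
          Set.indicator_of_mem (show r ∈ etaRad ⁻¹' B from h1), hdens, Pi.one_apply, mul_one]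
      · rw [Set.indicator_of_notMem (fun h => h1 (hmem.mp h).1),
          Set.indicator_of_notMem (show r ∉ etaRad ⁻¹' B from h1)]
        simp only [mul_zero]
    · rw [Set.indicator_of_notMem (fun h : r ∈ Ioo (0 : ℝ) 1 => h2 h.2),
        Set.indicator_of_notMem (fun h => h2 (hmem.mp h).2)]
      simp only [mul_zero]
  rw [h1, h2, setLIntegral_congr_fun (measurableSet_Ioi.prod measurableSet_Ioo) h3,
    Measure.volume_eq_prod, ← Measure.prod_restrict]
  have h4 := lintegral_prod_mul (μ := volume.restrict (Ioi (0 : ℝ)))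
    (ν := volume.restrict (Ioo (-π) π)) (measurable_radInt hB).aemeasurable
    (aemeasurable_const (b := (1 : ℝ≥0∞)))
  simp only [mul_one] at h4
  rw [h4, lintegral_const, Measure.restrict_apply_univ, Real.volume_Ioo, one_mul,
    show π - -π = 2 * π by ring]

/-- **The substitution `r = tanh (η/2)`**: `∫_{r>0} radInt B r dr = ∫_{η>0} 1_B(η) · sinh η / 4 dη`. -/
lemma lintegral_radInt (B : Set ℝ) :
    ∫⁻ r in Ioi (0 : ℝ), radInt B r =
      ∫⁻ η in Ioi (0 : ℝ), B.indicator (fun η => ENNReal.ofReal (Real.sinh η / 4)) η := by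
  unfold radInt
  rw [lintegral_indicator measurableSet_Ioo, Measure.restrict_restrict measurableSet_Ioo,
    Set.inter_eq_left.mpr Set.Ioo_subset_Ioi_self, ← tanh_half_image_Ioi,
    lintegral_image_eq_lintegral_abs_deriv_mul measurableSet_Ioi
      (fun η _ => (hasDerivAt_tanh_half η).hasDerivWithinAt) tanh_half_injective.injOn]
  refine setLIntegral_congr_fun measurableSet_Ioi ?_
  intro η hη
  have hη : 0 < η := hη
  have hj := jacobian_eq η
  have ht : 0 ≤ Real.tanh (η / 2) := (T5CartanCoordinates.tanh_pos_of_pos (half_pos hη)).le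
  have hpre : Real.tanh (η / 2) ∈ etaRad ⁻¹' B ↔ η ∈ B := by
    rw [Set.mem_preimage, etaRad_tanh_half]
  beta_reduce
  by_cases hB' : η ∈ B
  · rw [Set.indicator_of_mem (hpre.mpr hB'), Set.indicator_of_mem hB', Pi.one_apply, mul_one,
      ← ENNReal.ofReal_mul ht, ← ENNReal.ofReal_mul (abs_nonneg _), hj]
  · rw [Set.indicator_of_notMem (fun h => hB' (hpre.mp h)), Set.indicator_of_notMem hB']
    simp only [mul_zero]

/-- **`(η)_* poincare = π · ½ sinh η dη`**: the push-forward of the Poincaré measure of the disc under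
the radial Cartan parameter `etaDisc` is `π` times Rühl's radial measure. -/
theorem map_etaDisc_poincare : Measure.map etaDisc poincare = ENNReal.ofReal π • ruhlRadial := by
  ext B hB
  have hm1 : Measurable (B.indicator fun η => ENNReal.ofReal (Real.sinh η / 4)) :=
    (ENNReal.measurable_ofReal.comp (Real.measurable_sinh.div_const 4)).indicator hB
  have hm2 : Measurable (B.indicator fun η => ENNReal.ofReal (1 / 2 * Real.sinh η)) :=
    (ENNReal.measurable_ofReal.comp (Real.measurable_sinh.const_mul _)).indicator hB
  rw [Measure.map_apply measurable_etaDisc hB, poincare_preimage_eq B hB, lintegral_radInt B,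
    Measure.smul_apply, ruhlRadial, withDensity_apply _ hB, ← lintegral_indicator hB, smul_eq_mul,
    ← lintegral_mul_const _ hm1, ← lintegral_const_mul _ hm2]
  refine setLIntegral_congr_fun measurableSet_Ioi ?_
  intro η hη
  have hη : 0 < η := hη
  have hs : 0 ≤ Real.sinh η / 4 := by
    have := Real.sinh_pos_iff.mpr hη
    positivity
  beta_reduce
  by_cases hB' : η ∈ B
  · rw [Set.indicator_of_mem hB', Set.indicator_of_mem hB', ← ENNReal.ofReal_mul hs,
      ← ENNReal.ofReal_mul Real.pi_pos.le]
    congr 1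
    ring
  · rw [Set.indicator_of_notMem hB', Set.indicator_of_notMem hB', zero_mul, mul_zero]

/-! ### §4 Rühl's parameter on `SU(1,1)`: the fibration `Φ(z, u) = s(z) · rot u` -/

/-- Rühl's parameter `η(h) = 2 arsinh ‖h₁₀‖` on `SU(1,1)`. -/
noncomputable def etaS (h : SU11) : ℝ :=
  2 * Real.arsinh ‖((h : Matrix.SpecialLinearGroup (Fin 2) ℂ) : Matrix (Fin 2) (Fin 2) ℂ) 1 0‖

/-- Rühl's parameter `η(g) = 2 arsinh ‖g₁₀‖` on `U(1,1)`: `ArchDoublingDatum.eta` for the tautological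
matrix map `rep g = g`. -/
noncomputable def etaU (g : U11) : ℝ :=
  2 * Real.arsinh ‖((g : GL (Fin 2) ℂ) : Matrix (Fin 2) (Fin 2) ℂ) 1 0‖

/-- The `(1,0)` matrix entry is continuous on `SU(1,1)`. -/
lemma continuous_entryS :
    Continuous fun h : SU11 =>
      ((h : Matrix.SpecialLinearGroup (Fin 2) ℂ) : Matrix (Fin 2) (Fin 2) ℂ) 1 0 :=
  (continuous_subtype_val.comp continuous_subtype_val).matrix_elem 1 0

/-- `etaS` is measurable. -/
lemma measurable_etaS : Measurable etaS := by
  unfold etaS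
  exact (Real.continuous_arsinh.measurable.comp (continuous_entryS.norm.measurable)).const_mul 2

/-- The `(1,0)` entry of `Φ(z, u) = s(z) · rot u`: `conj (rad z · clamp z) · u`. -/
lemma entry_fib (z : ℂ) (u : Circle) :
    ((fib (z, u) : Matrix.SpecialLinearGroup (Fin 2) ℂ) : Matrix (Fin 2) (Fin 2) ℂ) 1 0 =
      (starRingEnd ℂ) ((rad z : ℂ) * clamp z) * (u : ℂ) := by
  have hsec : ((sec z : Matrix.SpecialLinearGroup (Fin 2) ℂ) : Matrix (Fin 2) (Fin 2) ℂ) =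
      T5PoincareDensity.su11 (rad z) ((rad z : ℂ) * clamp z) := rfl
  have hrot : ((rot u : Matrix.SpecialLinearGroup (Fin 2) ℂ) : Matrix (Fin 2) (Fin 2) ℂ) =
      T5PoincareDensity.su11 (u : ℂ) 0 := rfl
  show (((sec z * rot u : SU11) : Matrix.SpecialLinearGroup (Fin 2) ℂ) : Matrix (Fin 2) (Fin 2) ℂ) 1 0 = _
  rw [Subgroup.coe_mul, Matrix.SpecialLinearGroup.coe_mul, hsec, hrot]
  simp [T5PoincareDensity.su11, Matrix.mul_apply, Fin.sum_univ_two]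

/-- **Rühl's parameter through the fibration**: `η(s(z) · rot u) = etaDisc z` for `z` in the disc. -/
lemma etaS_fib {z : ℂ} (hz : z ∈ ball (0 : ℂ) 1) (u : Circle) : etaS (fib (z, u)) = etaDisc z := by
  have hz1 : ‖z‖ < 1 := mem_ball_zero_iff.mp hz
  have hz' : Complex.normSq z < 1 := by
    rw [Complex.normSq_eq_norm_sq]
    nlinarith [norm_nonneg z]
  have hclamp : clamp z = z := if_pos hz'
  have hrad : rad z = (Real.sqrt (1 - ‖z‖ ^ 2))⁻¹ := by
    rw [rad, hclamp, Complex.normSq_eq_norm_sq]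
  unfold etaS etaDisc etaRad
  rw [entry_fib, norm_mul, Circle.norm_coe, mul_one, Complex.norm_conj, norm_mul, hclamp,
    Complex.norm_real, Real.norm_eq_abs, abs_of_pos (rad_pos z), hrad,
    mul_comm ((Real.sqrt (1 - ‖z‖ ^ 2))⁻¹) ‖z‖, ← div_eq_mul_inv]

section circle

variable [MeasurableSpace Circle] [BorelSpace Circle]

/-- `η ∘ Φ = etaDisc ∘ fst` almost everywhere for `poincare ⊗ haarCircle` (the complement of the disc is
`poincare`-null). -/
lemma etaS_comp_fib_ae :
    (etaS ∘ fib) =ᵐ[poincare.prod haarCircle] (etaDisc ∘ Prod.fst) := by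
  have h0 : poincare (ball (0 : ℂ) 1)ᶜ = 0 := by
    rw [poincare, withDensity_apply _ measurableSet_ball.compl,
      Measure.restrict_restrict measurableSet_ball.compl, Set.compl_inter_self,
      Measure.restrict_empty, lintegral_zero_measure]
  have hnull : (poincare.prod haarCircle) ((ball (0 : ℂ) 1)ᶜ ×ˢ (univ : Set Circle)) = 0 := by
    rw [Measure.prod_prod, h0, zero_mul]
  rw [Filter.EventuallyEq, ae_iff]
  refine measure_mono_null ?_ hnull
  intro p hp
  simp only [Set.mem_setOf_eq, Function.comp] at hp
  refine ⟨fun hz => hp ?_, Set.mem_univ _⟩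
  exact etaS_fib hz p.2

/-- **The push-forward of the fibration measure `ν = Φ_*(poincare ⊗ haarCircle)` under Rühl's
parameter is `π · ½ sinh η dη`.** -/
theorem map_etaS_nu : Measure.map etaS (nu haarCircle) = ENNReal.ofReal π • ruhlRadial := by
  haveI : IsProbabilityMeasure (haarCircle : Measure Circle) := ⟨haarCircle_univ⟩
  rw [nu, Measure.map_map measurable_etaS measurable_fib, Measure.map_congr etaS_comp_fib_ae,
    ← Measure.map_map measurable_etaDisc measurable_fst, Measure.map_fst_prod, measure_univ,
    one_smul, map_etaDisc_poincare]

/-- **Rühl's radial formula on `SU(1,1)`**: for every Haar measure `μ` of `SU(1,1)`,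
`η_* μ = c · ½ sinh η dη` on `η > 0` with `c > 0`. -/
theorem exists_map_etaS_eq (μS : Measure SU11) [IsHaarMeasure μS] :
    ∃ c : ℝ≥0, 0 < c ∧ Measure.map etaS μS = (c : ℝ≥0∞) • ruhlRadial := by
  have hnu := nu_eq_smul haarCircle μS
  have hc₂pos : 0 < haarScalarFactor (nu haarCircle) μS := haarScalarFactor_nu_pos haarCircle μS
  set c₂ := haarScalarFactor (nu haarCircle) μS with hc₂
  have hμS : μS = ((c₂ : ℝ≥0∞)⁻¹) • nu haarCircle := by
    rw [hnu, ← Measure.coe_nnreal_smul, smul_smul,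
      ENNReal.inv_mul_cancel (by exact_mod_cast hc₂pos.ne') ENNReal.coe_ne_top, one_smul]
  refine ⟨c₂⁻¹ * ⟨π, Real.pi_pos.le⟩, mul_pos (inv_pos.mpr hc₂pos)
    ((NNReal.coe_pos (r := ⟨π, Real.pi_pos.le⟩)).mp Real.pi_pos), ?_⟩
  rw [hμS, Measure.map_smul, map_etaS_nu, smul_smul, ENNReal.coe_mul, ENNReal.coe_inv hc₂pos.ne',
    ENNReal.ofReal_eq_coe_nnreal Real.pi_pos.le]
  rfl

end circle

/-! ### §5 Rühl's parameter on `U(1,1) = Z · SU(1,1)`: the product formula -/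

section u11

/-- The `(1,0)` matrix entry is continuous on `U(1,1)`. -/
lemma continuous_entryU :
    Continuous fun g : U11 => ((g : GL (Fin 2) ℂ) : Matrix (Fin 2) (Fin 2) ℂ) 1 0 :=
  (Units.continuous_val.comp continuous_subtype_val).matrix_elem 1 0

/-- Rühl's parameter is invariant under the centre: `η(λ · h) = η(h)`. -/
lemma etaU_mulHom (p : Circle × SU11) : etaU (mulHom p) = etaS p.2 := by
  unfold etaU etaS
  rw [coe_mulHom, Matrix.smul_apply, norm_smul, Circle.norm_coe, one_mul]

variable [MeasurableSpace U11] [BorelSpace U11]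

/-- `etaU` is measurable (for any Borel structure on `U(1,1)`). -/
lemma measurable_etaU : Measurable etaU := by
  unfold etaU
  exact (Real.continuous_arsinh.measurable.comp (continuous_entryU.norm.measurable)).const_mul 2

/-- **Rühl's radial formula on `U(1,1)`**: for every Haar measure `μ` of `U(1,1)` (any Borel structure),
`η_* μ = c · ½ sinh η dη` on `η > 0` with `c > 0`. -/
theorem exists_map_etaU_eq (μU : Measure U11) [IsHaarMeasure μU] :
    ∃ c : ℝ≥0, 0 < c ∧ Measure.map etaU μU = (c : ℝ≥0∞) • ruhlRadial := by
  letI : MeasurableSpace Circle := borel Circle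
  haveI : BorelSpace Circle := ⟨rfl⟩
  haveI : IsProbabilityMeasure (haarCircle : Measure Circle) := ⟨haarCircle_univ⟩
  obtain ⟨c₃, hc₃, h3⟩ := exists_map_etaS_eq (haar : Measure SU11)
  have hprod := map_mulHom_prod_eq_smul haarCircle (haar : Measure SU11) μU
  have hc₁pos : 0 < haarScalarFactor (map mulHom (haarCircle.prod (haar : Measure SU11))) μU :=
    T5U11Product.haarScalarFactor_pos haarCircle haar μU
  set c₁ := haarScalarFactor (map mulHom (haarCircle.prod (haar : Measure SU11))) μU with hc₁
  have hμU : μU = (c₁ : ℝ≥0∞)⁻¹ • map mulHom (haarCircle.prod (haar : Measure SU11)) := by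
    rw [hprod, ← Measure.coe_nnreal_smul, smul_smul,
      ENNReal.inv_mul_cancel (by exact_mod_cast hc₁pos.ne') ENNReal.coe_ne_top, one_smul]
  refine ⟨c₁⁻¹ * c₃, mul_pos (inv_pos.mpr hc₁pos) hc₃, ?_⟩
  rw [hμU, Measure.map_smul, Measure.map_map measurable_etaU continuous_mulHom.measurable,
    show etaU ∘ mulHom = etaS ∘ Prod.snd from funext etaU_mulHom,
    ← Measure.map_map measurable_etaS measurable_snd, Measure.map_snd_prod, measure_univ, one_smul,
    h3, smul_smul, ENNReal.coe_mul, ENNReal.coe_inv hc₁pos.ne']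

/-! ### §6 the display `Hyp.Ruhl1970_A2f` is a theorem on the carrier `U(1,1)` -/

/-- **The Rühl display is a THEOREM on `U(1,1)`**: for every archimedean doubling datum `𝒟` on the
carrier `U(1,1)` whose matrix map is the tautological one and whose measure is a Haar measure,
`Hyp.Ruhl1970_A2f 𝒟` holds — Rühl's radial formula `η_* μ = c · ½ sinh η dη` is DERIVED from Mathlib's
Haar measure and p1's fibration theorem, not displayed. -/
theorem ruhl_A2f_of_eq (𝒟 : ArchDoublingDatum U11 T5UnitaryBound.MemU11) (μ : Measure U11)
    [IsHaarMeasure μ] (hμ : 𝒟.μ = μ)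
    (hrep : ∀ g, 𝒟.rep g = ((g : GL (Fin 2) ℂ) : Matrix (Fin 2) (Fin 2) ℂ)) :
    Hyp.Ruhl1970_A2f 𝒟 := by
  obtain ⟨c, hc, h⟩ := exists_map_etaU_eq μ
  refine ⟨c, NNReal.coe_pos.mpr hc, ?_⟩
  have heta : 𝒟.eta = etaU := funext fun g => by simp only [ArchDoublingDatum.eta, etaU, hrep]
  rw [heta, hμ, h, ENNReal.ofReal_coe_nnreal]
  rfl

end u11

end Summit.Ventures.HodgeRepro2.T6.N43RuhlHaar
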